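import Summits.BirchSwinnertonDyer.Rank1Residual.X9.MainConjectureInstancesN3
import Summits.BirchSwinnertonDyer.Rank1Residual.X9.ChaDescentRecordsS4
import Summits.BirchSwinnertonDyer.Rank1Residual.X9.ChaDescentRecordsSeven
import Summits.BirchSwinnertonDyer.Rank1Residual.X9.ShapiroPairsJetchevRankZero
import HarnessLib

/-!
# Class X9 (N3), rank `0`: Mazur's cyclotomic main conjecture INTEGRALLY WITH `μ = 0` — Greenberg's Conj. 1.11 — AT THE PAIR,
# part g: the N3 cells closed in the kernel by Cha's index bound (UPPER) + an exact `p`-descent line `Sel^p ≠ 0` with Cassels–Tate (LOWER); Cha's index bound (UPPER) + the full `5`-descent line over the degree-24 field with a Zimmert-CERTIFIED class group (LOWER); an EXACT Shapiro `5`-descent over the degree-`8` field (bnfcertify)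

HONEST FRAMING (cell `b2b-bsdres-*`, verbatim): the cell deletes COMBINATION-SHAPED residual classes of
the rank-≤1 BSD formula from PUBLISHED theorems only and TYPES the construction-shaped remainder; this
is not "finishing BSD". Class X9 stays TYPED at class level: its typed input `IntegralMainConjectureOnClassX9`
stays OPEN as a ∀-statement. Everything here is PER PAIR; nothing is booked; no named fact. Unit `b2b-bsdres-x9`,
gen 16 (class-closure N3 lead; E1 line 'typed target INHABITED at the pair' of `class-closure/N3/WEEK-2026-08-28.md`,
continuing gen 15's `X9/MainConjectureInstancesN3{,b,c,d}.lean` = 19 instances; with this part's 4 the count is 31).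

WHAT (as in part 1): gen 5's `mazurMainConjecture_with_mu_zero_of_bsdp` — at a good ordinary irreducible `p ≥ 5` with
`r_an(E) = 0`, BCS 2025 Thm. 1.1.2 (a) gives `char X(E/ℚ_∞) = (g)` with `ι g = p^k·L_p`; `BSD(E,p)` forces `k = 0` and ONE
unit coefficient of `ϖ·L_p(f_E, α)` (`hcert`) gives `μ(g) = 0` — composed (gen 15's integer-model form
`mazurMainConjecture_of_ainvs_of_bsdp`) with the pair's OWN kernel `BSD(E,p)` theorem, applied BY NAME with its binders
copied verbatim: `bsdp_c274752br1` (`X9/ChaDescentRecordsS4.lean`), `bsdp_c347328cd1` (`X9/ChaDescentRecordsS4.lean`), `bsdp_s331056bi1` (`X9/ShapiroPairsJetchevRankZero.lean`), `bsdp_c378225bn1` (`X9/ChaDescentRecordsSeven.lean`). Good ordinary reduction and irreducibility are decided in the kernel from the integer model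
(`card_m<label>_<ℓ>`, or the record file's own point-count lemma reused by name); `hcert` = gen 9 `HOME/b2b-bsdres-x9/g9/mu/MU-ALL.tsv` (two engines, 790/790 X9 pairs), confirmed for
every N3 cell by a THIRD method (iw-1 GEN 11 `MU-CENSUS-N2N3`, 118/118 agree). Instance binders `[IsElliptic]`,
`[IsGloballyMinimal]` are dischargeable by Kraus' bounded criterion as in the record files.

References: Greenberg, LNM 1716 (1999) Conj. 1.11, Thm. 4.1; Burungale–Castella–Skinner IMRN 2025 Thm. 1.1.2 (a);
Cha 2005 / Miller 2011 Thm. 5.2; Greenberg–Vatsal 2000 §3; Mazur 1978 Prop. 6.3 (1); Cremona's tables.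
-/

set_option autoImplicit false

noncomputable section

open scoped Classical MatrixGroups ModularForm

open CongruenceSubgroup WeierstrassCurve Literature.NumberTheory.EllipticCurves
  Literature.NumberTheory.EllipticCurves.ModularForms Literature.NumberTheory.EllipticCurves.Rank1Residual
  Literature.NumberTheory.EllipticCurves.Rank1Residual.Typed
  Literature.NumberTheory.EllipticCurves.Rank1Residual.X11RankOneCertificates
  Summit.BirchSwinnertonDyer.BirchSwinnertonDyer.Rank1Residual.IntModel
  Summit.BirchSwinnertonDyer.BirchSwinnertonDyer.Rank1Residual.X11RankOne
  Summit.BirchSwinnertonDyer.Rank1Residual.X11b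

namespace Summit.BirchSwinnertonDyer.Rank1Residual.X9

/-! ### Kernel data -/

/-- `#Ẽ(𝔽₅) = 4` (`a₅ = 2`: good ORDINARY) for Cremona's model `274752br1` (kernel count). [folklore] -/
theorem card_m274752br1_5 :
    Nat.card (((⟨0, 0, 0, -64224, -5261472⟩ : WeierstrassCurve ℤ).map
      (Int.castRingHom (ZMod 5))).toAffine.Point) = 4 := by
  rw [@WeierstrassCurve.natCard_point_eq_one_add_card (ZMod 5) (@ZMod.instField 5 ⟨by norm_num⟩) _ _ _
    (by decide +kernel), @card_sol_eq_sum_euler (ZMod 5) (@ZMod.instField 5 ⟨by norm_num⟩) _ _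
    (by rw [ZMod.ringChar_zmod_n]; decide), ZMod.card]
  decide +kernel


/-- `#Ẽ(𝔽₅) = 4` (`a₅ = 2`: good ORDINARY) for Cremona's model `347328cd1` (kernel count). [folklore] -/
theorem card_m347328cd1_5 :
    Nat.card (((⟨0, 0, 0, -578304, -169277832⟩ : WeierstrassCurve ℤ).map
      (Int.castRingHom (ZMod 5))).toAffine.Point) = 4 := by
  rw [@WeierstrassCurve.natCard_point_eq_one_add_card (ZMod 5) (@ZMod.instField 5 ⟨by norm_num⟩) _ _ _
    (by decide +kernel), @card_sol_eq_sum_euler (ZMod 5) (@ZMod.instField 5 ⟨by norm_num⟩) _ _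
    (by rw [ZMod.ringChar_zmod_n]; decide), ZMod.card]
  decide +kernel


/-- `#Ẽ(𝔽₅) = 8` (`a₅ = -2`: good ORDINARY) for Cremona's model `331056bi1` (kernel count). [folklore] -/
theorem card_m331056bi1_5 :
    Nat.card (((⟨0, 0, 0, -136209216, 619829897456⟩ : WeierstrassCurve ℤ).map
      (Int.castRingHom (ZMod 5))).toAffine.Point) = 8 := by
  rw [@WeierstrassCurve.natCard_point_eq_one_add_card (ZMod 5) (@ZMod.instField 5 ⟨by norm_num⟩) _ _ _
    (by decide +kernel), @card_sol_eq_sum_euler (ZMod 5) (@ZMod.instField 5 ⟨by norm_num⟩) _ _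
    (by rw [ZMod.ringChar_zmod_n]; decide), ZMod.card]
  decide +kernel

/-- `#Ẽ(𝔽₇) = 8` (`a₇ = 0`; root-free mod `5`) for Cremona's model `331056bi1` (kernel count). [folklore] -/
theorem card_m331056bi1_7 :
    Nat.card (((⟨0, 0, 0, -136209216, 619829897456⟩ : WeierstrassCurve ℤ).map
      (Int.castRingHom (ZMod 7))).toAffine.Point) = 8 := by
  rw [@WeierstrassCurve.natCard_point_eq_one_add_card (ZMod 7) (@ZMod.instField 7 ⟨by norm_num⟩) _ _ _
    (by decide +kernel), @card_sol_eq_sum_euler (ZMod 7) (@ZMod.instField 7 ⟨by norm_num⟩) _ _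
    (by rw [ZMod.ringChar_zmod_n]; decide), ZMod.card]
  decide +kernel


/-- `#Ẽ(𝔽₇) = 6` (`a₇ = 2`: good ORDINARY) for Cremona's model `378225bn1` (kernel count). [folklore] -/
theorem card_m378225bn1_7 :
    Nat.card (((⟨0, 0, 1, 975820500, -127777886357344⟩ : WeierstrassCurve ℤ).map
      (Int.castRingHom (ZMod 7))).toAffine.Point) = 6 := by
  rw [@WeierstrassCurve.natCard_point_eq_one_add_card (ZMod 7) (@ZMod.instField 7 ⟨by norm_num⟩) _ _ _
    (by decide +kernel), @card_sol_eq_sum_euler (ZMod 7) (@ZMod.instField 7 ⟨by norm_num⟩) _ _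
    (by rw [ZMod.ringChar_zmod_n]; decide), ZMod.card]
  decide +kernel


/-! ### The instances -/

/-- **Mazur's main conjecture with `μ = 0` for `(274752br1, 5)`** (Cremona model `[0, 0, 0, -64224, -5261472]`; good ORDINARY at `5`, `a₅ = 2`,
`#Ẽ(𝔽₅) = 4`; `ρ̄_{E,5}` irreducible — Frobenius witness `ℓ = 11`: `#Ẽ(𝔽₁₁) = 8`, `a₁₁ = 4`, `X² − a₁₁X + 11` root-free
mod `5` — and, census datum, NOT surjective (N3 residue cell of `class-closure/N3/pairs.tsv`); `r_an = 0`): the N3 typed target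
(Greenberg's Conj. 1.11 / `IntegralMainConjectureOnClassX9` at the pair) INHABITED at this pair — from the kernel theorem `bsdp_c274752br1`
(`X9/ChaDescentRecordsS4.lean`: `BSD(E,5)` by Cha's index bound (UPPER) + the full `5`-descent line over the degree-24 field with a Zimmert-CERTIFIED class group (LOWER), gen 13; its binders are copied verbatim below) and the certificate
`hcert` (`μ(𝓛₅(E)) = 0`: gen 9 `MU-ALL.tsv`, engines B and C, `λ = 2`; iw-1 GEN 11 `MU-CENSUS-N2N3` third method: `UnitCoeff(k=2,n=4,cden=0):B+C`, unit index 2). Composition: gen 15's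
`mazurMainConjecture_of_ainvs_of_bsdp` (BCS 2025 Thm. 1.1.2 (a) exponent forced to `0` by `BSD(E,5)`, unit content from `hcert`).
Per pair; the class-level statement stays OPEN; nothing booked. [cite: GreenbergLNM1716, §1 Conj. 1.11 and Thm. 4.1 (p. 102)]
[cite: BurungaleCastellaSkinner2025, Thm. 1.1.2 (a) (p. 2 of arXiv:2405.00270v2)] [cite: Cremona2006, Table 1 (Cremona label 274752br1)] -/
theorem mazurMainConjecture_c274752br1
    (hBCS : burungale_castella_skinner_charIdeal_eq_padicLFunction)
    (hGr : greenberg_charValue_rankZero)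
    (h5 : realPeriodRat_eq_unit_mul_plusPeriod)
    (hmodL : hasEntireLFunction_rat)
    (hGZK : rank_eq_analyticRank_of_analyticRank_le_one)
    (hCT : exists_casselsTate_pairing (K := ℚ))
    (hCha : Cha2005.thm52_padicValNat_shaOrder_le)
    (W : WeierstrassCurve ℚ) [W.IsElliptic] [W.IsGloballyMinimal] [Fact (Nat.Prime 5)]
    (hW : W = ⟨0, 0, 0, -64224, -5261472⟩)
    (hr : W.analyticRank = 0)
    {N : ℕ}
    [NeZero N]
    {K : Type}
    [Field K]
    [NumberField K]
    (hK : IsImaginaryQuadratic K)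
    (hH : SatisfiesHeegnerHypothesis N K)
    {P : (W.baseChange K).toAffine.Point}
    (hP : IsHeegnerPoint N W K P)
    (hnt : ¬ IsOfFinAddOrder P)
    (hpD : ¬ (5 : ℤ) ∣ NumberField.discr K)
    (hpN : ¬ 5 ^ 2 ∣ N)
    (hI : padicValNat 5 (AddSubgroup.zmultiples P).index ≤ 1)
    {q : ℚ}
    (hq : shaAn W = (q : ℂ))
    (hv : padicValRat 5 q = 2)
    (hSel : W.selmerGroup (5 : ℤ) ≠ ⊥)
    (hcert : ∀ [NeZero (W.conductorNorm ℤ)] (f : CuspForm (Gamma0 (W.conductorNorm ℤ)) 2),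
        IsNewformOf W f → ∀ (ϖ : ℚ), (ϖ : ℝ) * W.realPeriodRat = plusPeriod f →
      ∃ m : ℕ, ‖PowerSeries.coeff m
        (PowerSeries.C (ϖ : ℚ_[5]) * padicLFunction f (unitRoot W 5 : ℚ_[5]))‖ = 1) :
    ∀ (κ : ZpExtension ℚ 5) (γ : Field.absoluteGaloisGroup ℚ),
        κ.IsCyclotomic → κ.IsTopGenerator γ → IsCyclotomicVariable 5 γ →
      ∀ [NeZero (W.conductorNorm ℤ)] (f : CuspForm (Gamma0 (W.conductorNorm ℤ)) 2),
        IsNewformOf W f → ∀ (ϖ : ℚ), (ϖ : ℝ) * W.realPeriodRat = plusPeriod f →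
      ∀ (D : W.SelmerDualData κ γ), D.IsTorsion ∧
        ∃ g : IwasawaAlgebra 5, D.charIdeal = Ideal.span {g} ∧
          GreenbergVatsal2000.HasUnitContent g ∧
          iwasawaToPowerSeries 5 g =
            PowerSeries.C (ϖ : ℚ_[5]) * padicLFunction f (unitRoot W 5 : ℚ_[5]) := by
  have hbsd : BSDp W 5 := bsdp_c274752br1 hGZK hCT hCha W hW hr hK hH hP hnt hpD hpN hI hq hv hSel
  have hIW : integralModelInt W = ⟨0, 0, 0, -64224, -5261472⟩ :=
    integralModelInt_eq_of_map_eq _ (by rw [hW]; ext <;> simp [WeierstrassCurve.map])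
  haveI : Fact (Nat.Prime 11) := ⟨by norm_num⟩
  exact mazurMainConjecture_of_ainvs_of_bsdp hBCS hGr h5 hmodL hGZK 0 0 0 (-64224) (-5261472) hIW 5 11 8 4 (by norm_num)
    (by decide +kernel) card_m274752br1_5 (by decide) (by decide) (by decide +kernel) card_c274752br1_11 (by decide)
    hr hbsd hcert

/-- **Mazur's main conjecture with `μ = 0` for `(347328cd1, 5)`** (Cremona model `[0, 0, 0, -578304, -169277832]`; good ORDINARY at `5`, `a₅ = 2`,
`#Ẽ(𝔽₅) = 4`; `ρ̄_{E,5}` irreducible — Frobenius witness `ℓ = 11`: `#Ẽ(𝔽₁₁) = 8`, `a₁₁ = 4`, `X² − a₁₁X + 11` root-free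
mod `5` — and, census datum, NOT surjective (N3 residue cell of `class-closure/N3/pairs.tsv`); `r_an = 0`): the N3 typed target
(Greenberg's Conj. 1.11 / `IntegralMainConjectureOnClassX9` at the pair) INHABITED at this pair — from the kernel theorem `bsdp_c347328cd1`
(`X9/ChaDescentRecordsS4.lean`: `BSD(E,5)` by Cha's index bound (UPPER) + the full `5`-descent line over the degree-24 field with a Zimmert-CERTIFIED class group (LOWER), gen 13; its binders are copied verbatim below) and the certificate
`hcert` (`μ(𝓛₅(E)) = 0`: gen 9 `MU-ALL.tsv`, engines B and C, `λ = 2`; iw-1 GEN 11 `MU-CENSUS-N2N3` third method: `UnitCoeff(k=2,n=4,cden=0):B+C`, unit index 2). Composition: gen 15's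
`mazurMainConjecture_of_ainvs_of_bsdp` (BCS 2025 Thm. 1.1.2 (a) exponent forced to `0` by `BSD(E,5)`, unit content from `hcert`).
Per pair; the class-level statement stays OPEN; nothing booked. [cite: GreenbergLNM1716, §1 Conj. 1.11 and Thm. 4.1 (p. 102)]
[cite: BurungaleCastellaSkinner2025, Thm. 1.1.2 (a) (p. 2 of arXiv:2405.00270v2)] [cite: Cremona2006, Table 1 (Cremona label 347328cd1)] -/
theorem mazurMainConjecture_c347328cd1
    (hBCS : burungale_castella_skinner_charIdeal_eq_padicLFunction)
    (hGr : greenberg_charValue_rankZero)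
    (h5 : realPeriodRat_eq_unit_mul_plusPeriod)
    (hmodL : hasEntireLFunction_rat)
    (hGZK : rank_eq_analyticRank_of_analyticRank_le_one)
    (hCT : exists_casselsTate_pairing (K := ℚ))
    (hCha : Cha2005.thm52_padicValNat_shaOrder_le)
    (W : WeierstrassCurve ℚ) [W.IsElliptic] [W.IsGloballyMinimal] [Fact (Nat.Prime 5)]
    (hW : W = ⟨0, 0, 0, -578304, -169277832⟩)
    (hr : W.analyticRank = 0)
    {N : ℕ}
    [NeZero N]
    {K : Type}
    [Field K]
    [NumberField K]
    (hK : IsImaginaryQuadratic K)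
    (hH : SatisfiesHeegnerHypothesis N K)
    {P : (W.baseChange K).toAffine.Point}
    (hP : IsHeegnerPoint N W K P)
    (hnt : ¬ IsOfFinAddOrder P)
    (hpD : ¬ (5 : ℤ) ∣ NumberField.discr K)
    (hpN : ¬ 5 ^ 2 ∣ N)
    (hI : padicValNat 5 (AddSubgroup.zmultiples P).index ≤ 1)
    {q : ℚ}
    (hq : shaAn W = (q : ℂ))
    (hv : padicValRat 5 q = 2)
    (hSel : W.selmerGroup (5 : ℤ) ≠ ⊥)
    (hcert : ∀ [NeZero (W.conductorNorm ℤ)] (f : CuspForm (Gamma0 (W.conductorNorm ℤ)) 2),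
        IsNewformOf W f → ∀ (ϖ : ℚ), (ϖ : ℝ) * W.realPeriodRat = plusPeriod f →
      ∃ m : ℕ, ‖PowerSeries.coeff m
        (PowerSeries.C (ϖ : ℚ_[5]) * padicLFunction f (unitRoot W 5 : ℚ_[5]))‖ = 1) :
    ∀ (κ : ZpExtension ℚ 5) (γ : Field.absoluteGaloisGroup ℚ),
        κ.IsCyclotomic → κ.IsTopGenerator γ → IsCyclotomicVariable 5 γ →
      ∀ [NeZero (W.conductorNorm ℤ)] (f : CuspForm (Gamma0 (W.conductorNorm ℤ)) 2),
        IsNewformOf W f → ∀ (ϖ : ℚ), (ϖ : ℝ) * W.realPeriodRat = plusPeriod f →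
      ∀ (D : W.SelmerDualData κ γ), D.IsTorsion ∧
        ∃ g : IwasawaAlgebra 5, D.charIdeal = Ideal.span {g} ∧
          GreenbergVatsal2000.HasUnitContent g ∧
          iwasawaToPowerSeries 5 g =
            PowerSeries.C (ϖ : ℚ_[5]) * padicLFunction f (unitRoot W 5 : ℚ_[5]) := by
  have hbsd : BSDp W 5 := bsdp_c347328cd1 hGZK hCT hCha W hW hr hK hH hP hnt hpD hpN hI hq hv hSel
  have hIW : integralModelInt W = ⟨0, 0, 0, -578304, -169277832⟩ :=
    integralModelInt_eq_of_map_eq _ (by rw [hW]; ext <;> simp [WeierstrassCurve.map])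
  haveI : Fact (Nat.Prime 11) := ⟨by norm_num⟩
  exact mazurMainConjecture_of_ainvs_of_bsdp hBCS hGr h5 hmodL hGZK 0 0 0 (-578304) (-169277832) hIW 5 11 8 4 (by norm_num)
    (by decide +kernel) card_m347328cd1_5 (by decide) (by decide) (by decide +kernel) card_c347328cd1_11 (by decide)
    hr hbsd hcert

/-- **Mazur's main conjecture with `μ = 0` for `(331056bi1, 5)`** (Cremona model `[0, 0, 0, -136209216, 619829897456]`; good ORDINARY at `5`, `a₅ = -2`,
`#Ẽ(𝔽₅) = 8`; `ρ̄_{E,5}` irreducible — Frobenius witness `ℓ = 7`: `#Ẽ(𝔽₇) = 8`, `a₇ = 0`, `X² − a₇X + 7` root-free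
mod `5` — and, census datum, NOT surjective (N3 residue cell of `class-closure/N3/pairs.tsv`); `r_an = 0`): the N3 typed target
(Greenberg's Conj. 1.11 / `IntegralMainConjectureOnClassX9` at the pair) INHABITED at this pair — from the kernel theorem `bsdp_s331056bi1`
(`X9/ShapiroPairsJetchevRankZero.lean`: `BSD(E,5)` by an EXACT Shapiro `5`-descent over the degree-`8` field (bnfcertify), gen 12; its binders are copied verbatim below) and the certificate
`hcert` (`μ(𝓛₅(E)) = 0`: gen 9 `MU-ALL.tsv`, engines B and C, `λ = 2`; iw-1 GEN 11 `MU-CENSUS-N2N3` third method: `UnitCoeff(k=2,n=4,cden=0):B+C`, unit index 2). Composition: gen 15's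
`mazurMainConjecture_of_ainvs_of_bsdp` (BCS 2025 Thm. 1.1.2 (a) exponent forced to `0` by `BSD(E,5)`, unit content from `hcert`).
Per pair; the class-level statement stays OPEN; nothing booked. [cite: GreenbergLNM1716, §1 Conj. 1.11 and Thm. 4.1 (p. 102)]
[cite: BurungaleCastellaSkinner2025, Thm. 1.1.2 (a) (p. 2 of arXiv:2405.00270v2)] [cite: Cremona2006, Table 1 (Cremona label 331056bi1)] -/
theorem mazurMainConjecture_s331056bi1
    (hBCS : burungale_castella_skinner_charIdeal_eq_padicLFunction)
    (hGr : greenberg_charValue_rankZero)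
    (h5 : realPeriodRat_eq_unit_mul_plusPeriod)
    (hmodL : hasEntireLFunction_rat)
    (hGZK : rank_eq_analyticRank_of_analyticRank_le_one)
    (W : WeierstrassCurve ℚ) [W.IsElliptic] [W.IsGloballyMinimal] [Fact (Nat.Prime 5)]
    (hW : W = ⟨0, 0, 0, -136209216, 619829897456⟩)
    (hr : W.analyticRank = 0)
    {q : ℚ}
    (hq : shaAn W = (q : ℂ))
    (hv : padicValRat 5 q = 0)
    (hSel : Nat.card (W.selmerGroup (5 : ℤ)) = 5 ^ W.analyticRank)
    (hcert : ∀ [NeZero (W.conductorNorm ℤ)] (f : CuspForm (Gamma0 (W.conductorNorm ℤ)) 2),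
        IsNewformOf W f → ∀ (ϖ : ℚ), (ϖ : ℝ) * W.realPeriodRat = plusPeriod f →
      ∃ m : ℕ, ‖PowerSeries.coeff m
        (PowerSeries.C (ϖ : ℚ_[5]) * padicLFunction f (unitRoot W 5 : ℚ_[5]))‖ = 1) :
    ∀ (κ : ZpExtension ℚ 5) (γ : Field.absoluteGaloisGroup ℚ),
        κ.IsCyclotomic → κ.IsTopGenerator γ → IsCyclotomicVariable 5 γ →
      ∀ [NeZero (W.conductorNorm ℤ)] (f : CuspForm (Gamma0 (W.conductorNorm ℤ)) 2),
        IsNewformOf W f → ∀ (ϖ : ℚ), (ϖ : ℝ) * W.realPeriodRat = plusPeriod f →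
      ∀ (D : W.SelmerDualData κ γ), D.IsTorsion ∧
        ∃ g : IwasawaAlgebra 5, D.charIdeal = Ideal.span {g} ∧
          GreenbergVatsal2000.HasUnitContent g ∧
          iwasawaToPowerSeries 5 g =
            PowerSeries.C (ϖ : ℚ_[5]) * padicLFunction f (unitRoot W 5 : ℚ_[5]) := by
  have hbsd : BSDp W 5 := bsdp_s331056bi1 hGZK W hW (by rw [hr]; norm_num) hq hv hSel
  have hIW : integralModelInt W = ⟨0, 0, 0, -136209216, 619829897456⟩ :=
    integralModelInt_eq_of_map_eq _ (by rw [hW]; ext <;> simp [WeierstrassCurve.map])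
  haveI : Fact (Nat.Prime 7) := ⟨by norm_num⟩
  exact mazurMainConjecture_of_ainvs_of_bsdp hBCS hGr h5 hmodL hGZK 0 0 0 (-136209216) 619829897456 hIW 5 7 8 8 (by norm_num)
    (by decide +kernel) card_m331056bi1_5 (by decide) (by decide) (by decide +kernel) card_m331056bi1_7 (by decide)
    hr hbsd hcert

/-- **Mazur's main conjecture with `μ = 0` for `(378225bn1, 7)`** (Cremona model `[0, 0, 1, 975820500, -127777886357344]`; good ORDINARY at `7`, `a₇ = 2`,
`#Ẽ(𝔽₇) = 6`; `ρ̄_{E,7}` irreducible — Frobenius witness `ℓ = 11`: `#Ẽ(𝔽₁₁) = 12`, `a₁₁ = 0`, `X² − a₁₁X + 11` root-free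
mod `7` — and, census datum, NOT surjective (N3 residue cell of `class-closure/N3/pairs.tsv`); `r_an = 0`): the N3 typed target
(Greenberg's Conj. 1.11 / `IntegralMainConjectureOnClassX9` at the pair) INHABITED at this pair — from the kernel theorem `bsdp_c378225bn1`
(`X9/ChaDescentRecordsSeven.lean`: `BSD(E,7)` by Cha's index bound (UPPER) + an exact `p`-descent line `Sel^p ≠ 0` with Cassels–Tate (LOWER), gens 12–13; its binders are copied verbatim below) and the certificate
`hcert` (`μ(𝓛₇(E)) = 0`: gen 9 `MU-ALL.tsv`, engines B and C, `λ = 2`; iw-1 GEN 11 `MU-CENSUS-N2N3` third method: `UnitCoeff(k=2,n=4,cden=0):B+C`, unit index 2). Composition: gen 15's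
`mazurMainConjecture_of_ainvs_of_bsdp` (BCS 2025 Thm. 1.1.2 (a) exponent forced to `0` by `BSD(E,7)`, unit content from `hcert`).
Per pair; the class-level statement stays OPEN; nothing booked. [cite: GreenbergLNM1716, §1 Conj. 1.11 and Thm. 4.1 (p. 102)]
[cite: BurungaleCastellaSkinner2025, Thm. 1.1.2 (a) (p. 2 of arXiv:2405.00270v2)] [cite: Cremona2006, Table 1 (Cremona label 378225bn1)] -/
theorem mazurMainConjecture_c378225bn1
    (hBCS : burungale_castella_skinner_charIdeal_eq_padicLFunction)
    (hGr : greenberg_charValue_rankZero)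
    (h5 : realPeriodRat_eq_unit_mul_plusPeriod)
    (hmodL : hasEntireLFunction_rat)
    (hGZK : rank_eq_analyticRank_of_analyticRank_le_one)
    (hCT : exists_casselsTate_pairing (K := ℚ))
    (hCha : Cha2005.thm52_padicValNat_shaOrder_le)
    (W : WeierstrassCurve ℚ) [W.IsElliptic] [W.IsGloballyMinimal] [Fact (Nat.Prime 7)]
    (hW : W = ⟨0, 0, 1, 975820500, -127777886357344⟩)
    (hr : W.analyticRank = 0)
    {N : ℕ}
    [NeZero N]
    {K : Type}
    [Field K]
    [NumberField K]
    (hK : IsImaginaryQuadratic K)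
    (hH : SatisfiesHeegnerHypothesis N K)
    {P : (W.baseChange K).toAffine.Point}
    (hP : IsHeegnerPoint N W K P)
    (hnt : ¬ IsOfFinAddOrder P)
    (hpD : ¬ (7 : ℤ) ∣ NumberField.discr K)
    (hpN : ¬ 7 ^ 2 ∣ N)
    (hI : padicValNat 7 (AddSubgroup.zmultiples P).index ≤ 1)
    {q : ℚ}
    (hq : shaAn W = (q : ℂ))
    (hv : padicValRat 7 q = 2)
    (hSel : W.selmerGroup (7 : ℤ) ≠ ⊥)
    (hcert : ∀ [NeZero (W.conductorNorm ℤ)] (f : CuspForm (Gamma0 (W.conductorNorm ℤ)) 2),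
        IsNewformOf W f → ∀ (ϖ : ℚ), (ϖ : ℝ) * W.realPeriodRat = plusPeriod f →
      ∃ m : ℕ, ‖PowerSeries.coeff m
        (PowerSeries.C (ϖ : ℚ_[7]) * padicLFunction f (unitRoot W 7 : ℚ_[7]))‖ = 1) :
    ∀ (κ : ZpExtension ℚ 7) (γ : Field.absoluteGaloisGroup ℚ),
        κ.IsCyclotomic → κ.IsTopGenerator γ → IsCyclotomicVariable 7 γ →
      ∀ [NeZero (W.conductorNorm ℤ)] (f : CuspForm (Gamma0 (W.conductorNorm ℤ)) 2),
        IsNewformOf W f → ∀ (ϖ : ℚ), (ϖ : ℝ) * W.realPeriodRat = plusPeriod f →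
      ∀ (D : W.SelmerDualData κ γ), D.IsTorsion ∧
        ∃ g : IwasawaAlgebra 7, D.charIdeal = Ideal.span {g} ∧
          GreenbergVatsal2000.HasUnitContent g ∧
          iwasawaToPowerSeries 7 g =
            PowerSeries.C (ϖ : ℚ_[7]) * padicLFunction f (unitRoot W 7 : ℚ_[7]) := by
  have hbsd : BSDp W 7 := bsdp_c378225bn1 hGZK hCT hCha W hW hr hK hH hP hnt hpD hpN hI hq hv hSel
  have hIW : integralModelInt W = ⟨0, 0, 1, 975820500, -127777886357344⟩ :=
    integralModelInt_eq_of_map_eq _ (by rw [hW]; ext <;> simp [WeierstrassCurve.map])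
  haveI : Fact (Nat.Prime 11) := ⟨by norm_num⟩
  exact mazurMainConjecture_of_ainvs_of_bsdp hBCS hGr h5 hmodL hGZK 0 0 1 975820500 (-127777886357344) hIW 7 11 12 6 (by norm_num)
    (by decide +kernel) card_m378225bn1_7 (by decide) (by decide) (by decide +kernel) card_c378225bn1_11 (by decide)
    hr hbsd hcert

end Summit.BirchSwinnertonDyer.Rank1Residual.X9

end
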